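import Mathlib
import Literature.NumberTheory.GaloisRepresentations.IntegralGaloisAction
import HarnessLib

/-!
# `q_v` is a `2`-adic unit at a finite place `v ∤ 2`

Stub `stub_residueCardNorm` of the line `Sketch` for the crux `TwoAdicBianchiProModularityLevel`
(stmt-Langlands-15110): for a finite place `v` of a number field `K` with `2 ∉ v`, the residue
cardinality `q_v = #(𝓞 K ⧸ v) = v.residueCard` has `‖q_v‖ = 1` in `ℚ̄₂ = PadicAlgCl 2`.

Proof: the residue field `𝓞 K ⧸ v` is a finite field of some prime characteristic `p`, so
`p ∈ v` and `q_v = p ^ m`; `p ≠ 2` because `2 ∉ v`; hence `q_v` is coprime to `2`, so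
`‖(q_v : ℚ_[2])‖ = 1` (`Padic.norm_natCast_eq_one_iff`), transported to `ℚ̄₂` along
`algebraMap ℚ_[2] (PadicAlgCl 2)` by `PadicAlgCl.norm_extends`.

Sources: Neukirch, *Algebraic Number Theory* (1999), Ch. I §6 (6.1) and §8 (residue fields of
number rings are finite of prime-power order); standard `p`-adic facts (Mathlib).  Nothing about
Hecke operators or Galois representations is in this file.
-/

set_option linter.dupNamespace false -- `Summit.Langlands.Langlands` is the mandated namespace (D-0017)

open scoped NumberField
open IsDedekindDomain

namespace Summit.Langlands.Langlands.Theorems.TwoAdicBianchiProModularityLevel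

-- adapted from `Literature/NumberTheory/GaloisRepresentations/ArtinConductorWildProofs.lean`
-- (`exists_prime_mem_residueCard_eq`), reproved here to keep the imports of this stub minimal.
/-- The residue characteristic `p` of the finite place `v`: a prime with `p ∈ v` and
`q_v = p ^ m` (`𝓞 K ⧸ v` is a finite field).
Ref: Neukirch, *Algebraic Number Theory* (1999), Ch. I §6, (6.1) and §8. [folklore] -/
theorem exists_prime_natCast_mem_residueCard_eq_pow {K : Type*} [Field K] [NumberField K]
    (v : HeightOneSpectrum (𝓞 K)) :
    ∃ p : ℕ, p.Prime ∧ (p : 𝓞 K) ∈ v.asIdeal ∧ ∃ m : ℕ, v.residueCard = p ^ m := by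
  classical
  haveI : Finite (𝓞 K ⧸ v.asIdeal) := v.asIdeal.finiteQuotientOfFreeOfNeBot v.ne_bot
  letI : Fintype (𝓞 K ⧸ v.asIdeal) := Fintype.ofFinite _
  haveI := v.isMaximal
  letI : Field (𝓞 K ⧸ v.asIdeal) := Ideal.Quotient.field v.asIdeal
  obtain ⟨p, hchar', n, hp, hcard⟩ := FiniteField.card' (𝓞 K ⧸ v.asIdeal)
  refine ⟨p, hp, ?_, n, ?_⟩
  · haveI := hchar'
    rw [← Ideal.Quotient.eq_zero_iff_mem, map_natCast]
    exact CharP.cast_eq_zero _ p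
  · rw [HeightOneSpectrum.residueCard_eq_card_quotient, Nat.card_eq_fintype_card, hcard]

/-- `‖n‖ = 1` in `ℚ̄_p = PadicAlgCl p` for a natural number `n` coprime to `p`
(the norm of `ℚ̄_p` extends the `p`-adic norm of `ℚ_p`). [folklore] -/
theorem norm_natCast_padicAlgCl_eq_one_of_coprime {p : ℕ} [Fact p.Prime] {n : ℕ}
    (hn : p.Coprime n) : ‖(n : PadicAlgCl p)‖ = 1 := by
  rw [← map_natCast (algebraMap ℚ_[p] (PadicAlgCl p)) n]
  change ‖((n : ℚ_[p]) : PadicAlgCl p)‖ = 1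
  rw [PadicAlgCl.norm_extends, Padic.norm_natCast_eq_one_iff]
  exact hn

/-- At a finite place `v ∤ 2` of a number field the residue cardinality `q_v = #(𝓞 K ⧸ v)` is a
power of the odd residue characteristic, hence a `2`-adic unit: `‖q_v‖ = 1` in `ℚ̄₂`.
Ref: Neukirch, *Algebraic Number Theory* (1999), Ch. I §6 (6.1), §8. [folklore] -/
theorem stub_residueCardNorm : ∀ (K : Type) [Field K] [NumberField K]
    (v : HeightOneSpectrum (𝓞 K)), ((2 : ℕ) : 𝓞 K) ∉ v.asIdeal →
    ‖((v.residueCard : ℕ) : PadicAlgCl 2)‖ = 1 := by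
  intro K _ _ v h2
  obtain ⟨p, hp, hpv, m, hm⟩ := exists_prime_natCast_mem_residueCard_eq_pow v
  have hp2 : 2 ≠ p := by
    rintro rfl
    exact h2 hpv
  rw [hm]
  exact norm_natCast_padicAlgCl_eq_one_of_coprime
    (((Nat.coprime_primes Nat.prime_two hp).mpr hp2).pow_right m)

end Summit.Langlands.Langlands.Theorems.TwoAdicBianchiProModularityLevel
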